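import Summits.ResolutionOfSingularities.ResolutionOfSingularities.Theorems.PurelyInseparableDim4LoopELocalEscapeUniform
import HarnessLib

/-!
# [OURS · res-dim4-pi · F4-C-loc] UNIFORM LOCAL WIN CERTIFICATES: a finite table over the prime field, checked by
  `decide`, certifying A-wins of the LOCAL in-scope game over EVERY field extension (format + soundness)

Cell `res-dim4-pi` (D-0157 DOOR 2, wave 2), seat `res-dim4-p-6` g2; the FORMAT offered at 21:12Z (WORD #66 (3)(a)):
res-dim4-p-6's `rwinCertB` (`…LoopCLocalEscape`, p663219) certifies `RWins q localB` over ONE finite field by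
enumerating the rational replies; this file's **`uwinCertB`** certifies `RWins q localB (liftHom f s)` over EVERY
field `K ⊇ f(k)` at once, row by row, from SYMBOLIC data only:

* a row is `(s, S, w, frc)`: a presented state `s` over `k`, A's centre `S` (checked permissible), and for every
  chart `j ∈ S` EITHER a maximal witness `w j = some γ` (`UniformNoReply.uniformWitnessB`: the `x^γ`-coefficient of
  the point transform is a non-zero constant — no equimultiple `K`-point over the current point at all) OR
  `w j = none` and for every free coordinate `i ∈ S ∖ {j}` an ORIGIN-FORCING pair `frc j i = (γ, e)`
  (**`forcesCoordB`**: `x^e` is the single source of `x^γ`, moving only in the coordinate `i`, with a binomial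
  non-zero in `k` — so `coeff_{x^γ} = c·bᵢ^d`, `c ≠ 0`, `d ≥ 1`, and an equimultiple point has `bᵢ = 0`); in the
  second case the chart-ORIGIN child `stepD q S j 0 s` (p-13's computed step) is `0` or a LATER row;
* **`rWins_lift_of_uwinCertB`** (soundness, induction on the table, scope handled as in `rWins_of_rrowOK`: if the
  lifted state is out of scope the position is won outright): every row's state, base-changed along ANY ring map
  `f : k →+* K` of fields, is an A-win of the local in-scope game over `K`.

Instances: `…LoopCLocalEscapeUniform` / `…HopRegionsLocalEscapeUniform` / `…LoopELocalEscapeUniform` are hand-written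
rows of this shape; the tables for LOOP-D `d1 … d6` and F3 `fc0` follow in `…HopRegionsLocalCertUniform`.  Limits
(honest): rows whose every chart is witness/forcing exist only when the `k`-certificate's replies are chart origins;
free fibre LINES of replies (LOOP-D `d0`, F3 `fc3`: no low-degree constraint at all) and `√−1`-type constraints
(`e3`: `β²(1+β²)`) are outside the format.  [OURS · counted 0 · format + soundness; AI kernel work, weaker than expert
review.]  NOTHING here is a statement about resolution of singularities; resolution in dimension `≥ 4` /
characteristic `p > 0` is NOT proved by anything in this file.  bears_on: LADDER-RESOLUTION:D157-DOOR2 (res-dim4-pi ·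
F4-C-loc all fields · certificate format).  Host item (DR-157-C): `stmt-ResolutionOfSingularities-16155`, helper.
-/

set_option linter.dupNamespace false -- mandated namespace of this single-conjunct summit

noncomputable section

open MvPolynomial Finset
open scoped BigOperators

namespace Summit.ResolutionOfSingularities.ResolutionOfSingularities.Theorems.PIDim4

namespace LoopCLocal

open Literature.AlgebraicGeometry.Resolution
open Literature.AlgebraicGeometry.Resolution.CentreBlowup
open StepKit LoopC UniformNoReply

section Generic

variable {k K : Type} [Field k] [Field K] [DecidableEq k] [DecidableEq K] (f : k →+* K)

/-! ## §1 Lifting along a ring map -/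

/-- the base change of a state along `f`. OURS. [folklore] -/
def liftHom (s : State k) : State K := ⟨MvPolynomial.map f s.F, s.r, s.exc⟩

/-- `liftState` of `…LoopCLocalEscapeUniform` is the case `f = 𝔽₃ ↪ L`. OURS. [folklore] -/
theorem liftHom_φ3 (L : Type) [Field L] [CharP L 3] (s : State (ZMod 3)) : liftHom (φ3 L) s = liftState L s := rfl

/-- **the chart-origin reply commutes with the lift** (child computed by `stepD`). OURS. [folklore] -/
theorem step_origin_liftHom (q : ℕ) (S : Finset (Fin 4)) (j : Fin 4) (s : SData 4 k) :
    CentreBlowup.step q S j (0 : Fin 4 → K) (liftHom f s.toState) = liftHom f (stepD q S j 0 s).toState := by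
  rw [liftHom, step_baseChange_zero f q S j s.toState, step_toState]
  rfl

omit [DecidableEq K] in
/-- legality of A's move at a lifted state: scope over `K` (assumed) and permissibility from the `k`-check.
OURS. [folklore] -/
theorem legal_liftHom {q : ℕ} {s : SData 4 k} (hsc : InCoordinateScope q (liftHom f s.toState).F)
    {S : Finset (Fin 4)} (hperm : permB q S s.L = true) :
    InCoordinateScope q (liftHom f s.toState).F ∧ IsPermissibleCentre q S (liftHom f s.toState).F :=
  ⟨hsc, (BaseChange.isPermissibleCentre_map_iff f q S s.toState.F).mpr ((isPermissibleCentre_iff q S s.L).mpr hperm)⟩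

/-! ## §2 Origin forcing, one free coordinate at a time -/

/-- **Coordinate-forcing certificate** `(γ, e)` for the free coordinate `i` of the chart `j`: `x^e` is the single
source of the low monomial `x^γ` at points vanishing off `S ∖ {j}`, `e` differs from `γ` only in the coordinate
`i`, `γᵢ < eᵢ`, and the binomial `C(eᵢ, γᵢ)` is non-zero in `k`. OURS. [folklore] -/
def forcesCoordB (q : ℕ) (S : Finset (Fin 4)) (j i : Fin 4) (F : Terms 4 k) (γe : (Fin 4 → ℕ) × (Fin 4 → ℕ)) :
    Bool :=
  singleSourceB q S j (S.erase j) F γe.1 γe.2 && decide (∀ m, m ≠ i → γe.1 m = γe.2 m) &&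
    decide (γe.1 i < γe.2 i) && !decide ((((γe.2 i).choose (γe.1 i) : ℕ) : k) = 0)

omit [DecidableEq K] in
/-- **A coordinate-forcing certificate kills that coordinate of every equimultiple `K`-point over the current
point** (`coeff_{x^γ}` of the point transform is `f(c_e)·C(eᵢ,γᵢ)·bᵢ^{eᵢ−γᵢ}`). OURS. [folklore] -/
theorem coord_eq_zero_of_forcesCoordB {q : ℕ} {S : Finset (Fin 4)} {j i : Fin 4} {s : SData 4 k}
    {γe : (Fin 4 → ℕ) × (Fin 4 → ℕ)} (h : forcesCoordB q S j i s.L γe = true) {b : Fin 4 → K} (hbj : b j = 0)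
    (hb : ∀ m : Fin 4, m ∉ S → b m = 0) (heq : IsEquimultiplePoint q S j b (liftHom f s.toState)) : b i = 0 := by
  simp only [forcesCoordB, Bool.and_eq_true, decide_eq_true_eq, Bool.not_eq_true', decide_eq_false_iff_not] at h
  obtain ⟨⟨⟨hss, hoff⟩, hlt⟩, hC⟩ := h
  have hprod := prod_eq_zero_of_isEquimultiplePoint_of_singleSourceB f hss (vanish_erase K hbj hb) heq
  obtain ⟨m, -, hm⟩ := Finset.prod_eq_zero_iff.mp hprod
  by_cases hmi : m = i
  · subst hmi
    have hCK : (((γe.2 m).choose (γe.1 m) : ℕ) : K) ≠ 0 := fun h0 =>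
      hC (f.injective (by rw [map_natCast, map_zero]; exact h0))
    exact (pow_eq_zero_iff (Nat.sub_ne_zero_of_lt hlt)).mp ((mul_eq_zero.mp hm).resolve_left hCK)
  · exfalso
    rw [hoff m hmi, Nat.sub_self, pow_zero, mul_one, Nat.choose_self, Nat.cast_one] at hm
    exact one_ne_zero hm

/-! ## §3 The table format -/

/-- a row: presented state, A's centre, per chart an optional maximal witness, per chart and free coordinate a
forcing pair. OURS. [folklore] -/
abbrev URow (k : Type) : Type :=
  SData 4 k × Finset (Fin 4) × (Fin 4 → Option (Fin 4 → ℕ)) × (Fin 4 → Fin 4 → (Fin 4 → ℕ) × (Fin 4 → ℕ))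

/-- a uniform local win certificate: a list of rows, parents before children. OURS. [folklore] -/
abbrev UCert (k : Type) : Type := List (URow k)

/-- the chart check: a maximal witness, or forcing pairs for every free coordinate. OURS. [folklore] -/
def chartOK (q : ℕ) (S : Finset (Fin 4)) (j : Fin 4) (F : Terms 4 k) (w : Option (Fin 4 → ℕ))
    (frc : Fin 4 → (Fin 4 → ℕ) × (Fin 4 → ℕ)) : Bool :=
  match w with
  | some γ => uniformWitnessB q S j (S.erase j) F γ
  | none => decide (∀ i ∈ S.erase j, forcesCoordB q S j i F (frc i) = true)

/-- the child check for a forcing chart: the origin child is `0` or a later row. OURS. [folklore] -/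
def uchildOK (q : ℕ) (rest : UCert k) (s : SData 4 k) (S : Finset (Fin 4)) (j : Fin 4) : Bool :=
  StepKit.equivB (stepD q S j 0 s).L [] || rest.any fun r => (stepD q S j 0 s).equivB r.1

/-- the row check. OURS. [folklore] -/
def urowOK (q : ℕ) (rest : UCert k) (row : URow k) : Bool :=
  permB q row.2.1 row.1.L &&
    decide (∀ j ∈ row.2.1, chartOK q row.2.1 j row.1.L (row.2.2.1 j) (row.2.2.2 j) = true ∧
      (row.2.2.1 j = none → uchildOK q rest row.1 row.2.1 j = true))

/-- **the uniform local win-certificate checker.** OURS. [folklore] -/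
def uwinCertB (q : ℕ) : UCert k → Bool
  | [] => true
  | row :: rest => urowOK q rest row && uwinCertB q rest

/-! ## §4 Soundness over every field extension -/

/-- **Soundness of one row**: if the later rows are A-wins over `K`, so is this row's lifted state — A plays the
certified centre; a `K`-reply in a witnessed chart is impossible, a `K`-reply in a forcing chart is the chart
origin, whose child is `0` (no successor) or a later row. OURS. [folklore] -/
theorem rWins_lift_of_urowOK {q : ℕ} {rest : UCert k} (hrest : ∀ r ∈ rest, RWins q localB (liftHom f r.1.toState))
    {row : URow k} (h : urowOK q rest row = true) : RWins q localB (liftHom f row.1.toState) := by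
  obtain ⟨s, S, w, frc⟩ := row
  simp only [urowOK, Bool.and_eq_true, decide_eq_true_eq] at h
  obtain ⟨hperm, hall⟩ := h
  by_cases hsc : InCoordinateScope q (liftHom f s.toState).F
  · refine Game.Wins.move (m := S) (legal_liftHom f hsc hperm) ?_
    rintro s' ⟨j, b, hj, hbj, hloc, heq, hne, rfl⟩
    have hb := (localB_eq_true_iff S j b).mp hloc
    obtain ⟨hchart, hchild⟩ := hall j hj
    cases hw : w j with
    | some γ =>
      rw [hw] at hchart
      exact absurd heq (not_isEquimultiplePoint_of_uniformWitnessB f hchart (vanish_erase K hbj hb))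
    | none =>
      rw [hw] at hchart
      simp only [chartOK, decide_eq_true_eq] at hchart
      have hb0 : b = 0 := by
        funext m
        by_cases hmj : m = j
        · rw [hmj]; exact hbj
        by_cases hmS : m ∈ S
        · exact coord_eq_zero_of_forcesCoordB f (hchart m (Finset.mem_erase.mpr ⟨hmj, hmS⟩)) hbj hb heq
        · exact hb m hmS
      subst hb0
      rw [step_origin_liftHom] at hne ⊢
      have hc := hchild hw
      unfold uchildOK at hc
      rw [Bool.or_eq_true] at hc
      rcases hc with hzero | hmem
      · exfalso
        apply hne
        show MvPolynomial.map f (evalT (stepD q S j 0 s).L) = 0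
        rw [(evalT_eq_zero_iff _).mpr hzero, map_zero]
      · obtain ⟨r, hr, hrc⟩ := List.any_eq_true.mp hmem
        rw [(toState_eq_iff _ _).mpr hrc]
        exact hrest r hr
  · exact Game.Wins.terminal fun _ hS' => hsc hS'.1

/-- **SOUNDNESS OF UNIFORM LOCAL WIN CERTIFICATES**: every row of a checked table, base-changed along any ring map
of fields `f : k →+* K`, is an A-win of the LOCAL in-scope game over `K`. OURS. [folklore] -/
theorem rWins_lift_of_uwinCertB {q : ℕ} :
    ∀ {T : UCert k}, uwinCertB q T = true → ∀ row ∈ T, RWins q localB (liftHom f row.1.toState)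
  | [], _ => fun row hrow => absurd hrow List.not_mem_nil
  | row :: rest, h => by
    unfold uwinCertB at h
    rw [Bool.and_eq_true] at h
    have hrest := rWins_lift_of_uwinCertB h.2
    intro r hr
    rcases List.mem_cons.mp hr with rfl | hr'
    · exact rWins_lift_of_urowOK f hrest h.1
    · exact hrest r hr'

/-- the head row of a checked table, lifted, is an A-win. OURS. [folklore] -/
theorem rWins_lift_of_uwinCertB_head {q : ℕ} {row : URow k} {rest : UCert k}
    (h : uwinCertB q (row :: rest) = true) : RWins q localB (liftHom f row.1.toState) :=
  rWins_lift_of_uwinCertB f h row List.mem_cons_self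

end Generic

/-! ## §5 A first instance: LOOP-C's `t1` row, re-certified in the format -/

/-- `t1` under `V(x₂,x₄)`: both charts witnessed (`x₄²`, `x₂`). [OURS · ‖ K] -/
def t1UCert : UCert (ZMod 3) :=
  [(t1, {1, 3}, ![none, some ![0, 0, 0, 2], none, some ![0, 1, 0, 0]], fun _ _ => (0, 0))]

/-- it checks. [OURS · ‖ K] -/
theorem uwinCertB_t1 : uwinCertB 3 t1UCert = true := by decide +kernel

/-- hence (again) `t1` is a local A-win over every field of characteristic 3 — now by the generic checker.
[OURS · ‖ K] -/
theorem rWins_t1_allFields' (L : Type) [Field L] [CharP L 3] [DecidableEq L] :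
    RWins 3 localB (liftHom (φ3 L) t1.toState) := by
  have h := rWins_lift_of_uwinCertB_head (φ3 L) uwinCertB_t1
  exact h

end LoopCLocal

end Summit.ResolutionOfSingularities.ResolutionOfSingularities.Theorems.PIDim4

end
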